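import Mathlib
import HarnessLib
import Summits.HubbardSuperconductivity.HubbardSuperconductivity.Theorems.KLProgrammeC4aBellRigidBounds

/-!
# Route `KLProgramme` — crux C4a, (L3) Bell dominators of a rigid path against ONE inverse power and ORDER-DEPENDENT sizes:
# `Mb_k ≤ Cb_k/m`, `Ds_i ≤ x·m`, `Ds_i ≤ y` ⟹ `bell4 Mb Ds j ≤ x·Q_j(Cb, y)` (+ the non-rigid monomial at `j = 4`)

Cell `gate-hubbard-kl`, lane hubbard-kl-c4a-1 (g5); helper for stub (C) `stub_twoLeg_curvature` of the engine-flow child `KLRegimeEngineV17F2`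
(stmt-HubbardSuperconductivity-20437); memo HOME/hubbard-kl-c4a-1/C4A-PLAN.md §22.9.  WHY THIS VARIANT of `…C4aBellRigidBounds` (`Mb_k ≤ Cb/m^k`): for the
ABOVE-SCALE bubble `B_{>Λ}` the `k`-th momentum derivative is NOT `≍ max(‖p‖,Λ)^{−k}` — derivatives falling on the scale cutoffs cost `Λ^{−1}` each, and only ONE
power of the distance to the Cooper point is gained by the transversality of the two Fermi curves (Salmhofer 1999 §4.5 Lemma 4.10 / Cor. 4.11: the intersection
volume and `B(q) ≤ c(2 + log(ε₀/‖q‖²))`): the honest shape is `‖DᵏB_{>Λ}(p)‖ ≤ Cb_k·max(c′‖p‖, Λ)^{−1}` with ORDER-DEPENDENT `Cb_k ≍ U²Λ^{1−k}` (up to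
logarithms).  One rigidity factor `Ds ≤ x·m` cancels the single inverse power; the remaining `k − 1` path-jet factors are bounded by a constant `y` (`δ ≤ r + π`).

* `monomial_le_one`, `monomial_le_one₂`, **`bell4_le_of_rigid_one`**: `bell4 Mb Ds 1 ≤ Cb₁x`, `bell4 Mb Ds 2 ≤ Cb₂xy + Cb₁x`,
  `bell4 Mb Ds 3 ≤ Cb₃xy² + 3Cb₂xy + Cb₁x`, `bell4 Mb Ds 4 ≤ Cb₄xy³ + 6Cb₃xy² + 7Cb₂xy + Mb 1·Ds 4`.

Elementary real inequalities; nothing about the Hubbard model; nothing asserts superconductivity.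
References: Salmhofer 1999 §4.5.2 Lemma 4.10, Cor. 4.11 [cite: Salmhofer1999]; BGM 2006 §2.4 (2.40) [cite: BenfattoGiulianiMastropietro2006].
-/

noncomputable section

namespace Summit.HubbardSuperconductivity.HubbardSuperconductivity.Theorems.C4a

set_option linter.dupNamespace false -- summit = problem name (single-conjunct summit), D-0017

open Real

/-- **One monomial, one inverse power**: `0 ≤ Mb ≤ Cb/m`, `0 ≤ D ≤ x·m`, `D ≤ y`, `1 ≤ k` ⟹ `Mb·D^k ≤ Cb·x·y^(k−1)`. -/
theorem monomial_le_one {Mb D m x y Cb : ℝ} {k : ℕ} (hm : 0 < m) (hMb0 : 0 ≤ Mb) (hMb : Mb ≤ Cb / m) (hD0 : 0 ≤ D) (hD : D ≤ x * m)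
    (hDy : D ≤ y) (hk : 1 ≤ k) : Mb * D ^ k ≤ Cb * x * y ^ (k - 1) := by
  have hx : 0 ≤ x * m := hD0.trans hD
  obtain ⟨j, rfl⟩ : ∃ j, k = j + 1 := ⟨k - 1, by omega⟩
  rw [Nat.add_sub_cancel, pow_succ]
  have hyj : D ^ j ≤ y ^ j := pow_le_pow_left₀ hD0 hDy j
  calc Mb * (D ^ j * D) ≤ Cb / m * (y ^ j * (x * m)) :=
        mul_le_mul hMb (mul_le_mul hyj hD hD0 (pow_nonneg (hD0.trans hDy) j)) (mul_nonneg (pow_nonneg hD0 j) hD0) (le_trans hMb0 hMb)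
    _ = Cb * x * y ^ j := by field_simp

/-- **Mixed monomial, one inverse power**: `Mb·D^a·D'^b ≤ Cb·x·y^(a+b−1)` for `1 ≤ a` (the `m`-cancellation uses one `D`-factor). -/
theorem monomial_le_one₂ {Mb D D' m x y Cb : ℝ} {a b : ℕ} (hm : 0 < m) (hMb0 : 0 ≤ Mb) (hMb : Mb ≤ Cb / m) (hD0 : 0 ≤ D) (hD : D ≤ x * m)
    (hDy : D ≤ y) (hD0' : 0 ≤ D') (hDy' : D' ≤ y) (ha : 1 ≤ a) : Mb * D ^ a * D' ^ b ≤ Cb * x * y ^ (a + b - 1) := by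
  obtain ⟨j, rfl⟩ : ∃ j, a = j + 1 := ⟨a - 1, by omega⟩
  rw [show j + 1 + b - 1 = j + b from by omega, pow_succ, pow_add]
  have hy : 0 ≤ y := hD0.trans hDy
  have hyj : D ^ j ≤ y ^ j := pow_le_pow_left₀ hD0 hDy j
  have hyb : D' ^ b ≤ y ^ b := pow_le_pow_left₀ hD0' hDy' b
  have h1 : D ^ j * D * D' ^ b ≤ y ^ j * (x * m) * y ^ b :=
    mul_le_mul (mul_le_mul hyj hD hD0 (pow_nonneg hy j)) hyb (pow_nonneg hD0' b) (mul_nonneg (pow_nonneg hy j) (hD0.trans hD))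
  calc Mb * (D ^ j * D) * D' ^ b = Mb * (D ^ j * D * D' ^ b) := by ring
    _ ≤ Cb / m * (y ^ j * (x * m) * y ^ b) :=
        mul_le_mul hMb h1 (mul_nonneg (mul_nonneg (pow_nonneg hD0 j) hD0) (pow_nonneg hD0' b)) (le_trans hMb0 hMb)
    _ = Cb * x * (y ^ j * y ^ b) := by field_simp

/-- **Bell dominators of a rigid path against ONE inverse power, order-dependent sizes.**  For `0 < m`, `0 ≤ Mb k ≤ Cb k/m` (`1 ≤ k ≤ 4`),
`0 ≤ Ds i` (`i ≤ 4`), `Ds i ≤ x·m` and `Ds i ≤ y` (`1 ≤ i ≤ 3`):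
`bell4 Mb Ds 1 ≤ Cb₁x`, `bell4 Mb Ds 2 ≤ Cb₂xy + Cb₁x`, `bell4 Mb Ds 3 ≤ Cb₃xy² + 3Cb₂xy + Cb₁x`, `bell4 Mb Ds 4 ≤ Cb₄xy³ + 6Cb₃xy² + 7Cb₂xy + Mb 1·Ds 4`.
[cite: BenfattoGiulianiMastropietro2006, §2.4 (2.40)] -/
theorem bell4_le_of_rigid_one {Mb Ds Cb : ℕ → ℝ} {m x y : ℝ} (hm : 0 < m) (hMb0 : ∀ k, 1 ≤ k → k ≤ 4 → 0 ≤ Mb k)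
    (hMb : ∀ k, 1 ≤ k → k ≤ 4 → Mb k ≤ Cb k / m) (hDs0 : ∀ i, 1 ≤ i → i ≤ 4 → 0 ≤ Ds i)
    (hDs : ∀ i, 1 ≤ i → i ≤ 3 → Ds i ≤ x * m) (hDy : ∀ i, 1 ≤ i → i ≤ 3 → Ds i ≤ y) :
    bell4 Mb Ds 1 ≤ Cb 1 * x ∧ bell4 Mb Ds 2 ≤ Cb 2 * x * y + Cb 1 * x ∧
      bell4 Mb Ds 3 ≤ Cb 3 * x * y ^ 2 + 3 * (Cb 2 * x * y) + Cb 1 * x ∧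
      bell4 Mb Ds 4 ≤ Cb 4 * x * y ^ 3 + 6 * (Cb 3 * x * y ^ 2) + 7 * (Cb 2 * x * y) + Mb 1 * Ds 4 := by
  have n1 := hMb0 1 le_rfl (by norm_num); have n2 := hMb0 2 (by norm_num) (by norm_num)
  have n3 := hMb0 3 (by norm_num) (by norm_num); have n4 := hMb0 4 (by norm_num) le_rfl
  have b1 := hMb 1 le_rfl (by norm_num); have b2 := hMb 2 (by norm_num) (by norm_num)
  have b3 := hMb 3 (by norm_num) (by norm_num); have b4 := hMb 4 (by norm_num) le_rfl
  have d1 := hDs0 1 le_rfl (by norm_num); have d2 := hDs0 2 (by norm_num) (by norm_num)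
  have d3 := hDs0 3 (by norm_num) (by norm_num)
  have e1 := hDs 1 le_rfl (by norm_num); have e2 := hDs 2 (by norm_num) (by norm_num); have e3 := hDs 3 (by norm_num) le_rfl
  have y1 := hDy 1 le_rfl (by norm_num); have y2 := hDy 2 (by norm_num) (by norm_num); have y3 := hDy 3 (by norm_num) le_rfl
  -- the monomials
  have m11 : Mb 1 * Ds 1 ≤ Cb 1 * x := by
    have h := monomial_le_one (k := 1) hm n1 b1 d1 e1 y1 le_rfl; simpa using h
  have m12 : Mb 1 * Ds 2 ≤ Cb 1 * x := by
    have h := monomial_le_one (k := 1) hm n1 b1 d2 e2 y2 le_rfl; simpa using h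
  have m13 : Mb 1 * Ds 3 ≤ Cb 1 * x := by
    have h := monomial_le_one (k := 1) hm n1 b1 d3 e3 y3 le_rfl; simpa using h
  have m21 : Mb 2 * Ds 1 ^ 2 ≤ Cb 2 * x * y := by
    have h := monomial_le_one (k := 2) hm n2 b2 d1 e1 y1 (by norm_num); simpa using h
  have m22 : Mb 2 * Ds 2 ^ 2 ≤ Cb 2 * x * y := by
    have h := monomial_le_one (k := 2) hm n2 b2 d2 e2 y2 (by norm_num); simpa using h
  have m2m : Mb 2 * Ds 1 ^ 1 * Ds 2 ^ 1 ≤ Cb 2 * x * y ^ (1 + 1 - 1) := monomial_le_one₂ hm n2 b2 d1 e1 y1 d2 y2 le_rfl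
  have m2m' : Mb 2 * Ds 1 ^ 1 * Ds 3 ^ 1 ≤ Cb 2 * x * y ^ (1 + 1 - 1) := monomial_le_one₂ hm n2 b2 d1 e1 y1 d3 y3 le_rfl
  have m31 : Mb 3 * Ds 1 ^ 3 ≤ Cb 3 * x * y ^ 2 := by
    have h := monomial_le_one (k := 3) hm n3 b3 d1 e1 y1 (by norm_num); simpa using h
  have m3m : Mb 3 * Ds 1 ^ 2 * Ds 2 ^ 1 ≤ Cb 3 * x * y ^ (2 + 1 - 1) := monomial_le_one₂ hm n3 b3 d1 e1 y1 d2 y2 (by norm_num)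
  have m41 : Mb 4 * Ds 1 ^ 4 ≤ Cb 4 * x * y ^ 3 := by
    have h := monomial_le_one (k := 4) hm n4 b4 d1 e1 y1 (by norm_num); simpa using h
  simp only [pow_one] at m2m m2m' m3m
  norm_num at m2m m2m' m3m
  refine ⟨?_, ?_, ?_, ?_⟩
  · simp only [bell4]; exact m11
  · simp only [bell4]; linarith
  · simp only [bell4]; nlinarith
  · simp only [bell4]; nlinarith

end Summit.HubbardSuperconductivity.HubbardSuperconductivity.Theorems.C4a

end
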